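import Mathlib
import Literature.AlgebraicGeometry.Resolution.NearPointsPointCentreUnique
import Literature.AlgebraicGeometry.Resolution.TauOne
import Literature.AlgebraicGeometry.Resolution.RsopAdaptedShift
import HarnessLib

/-!
# Near points over a point centre with `τ(x) = 1` lie on the strict transform of the directrix hyperplane (CoP1, Lemma 4.3 (5))

Topic: `Literature/AlgebraicGeometry/Resolution`. [CoP1] = Cossart–Piltant, J. Algebra 320 (2008)
1051–1082, Lemma 4.3 (5), p. 8, for the blowing up `q : X′ → X` of a regular threefold along the
closed point `Y = {x}`:

> "(5) If `τ(x) = 1` and `Y = {x}`, then those points `x′ ∈ q⁻¹(x)` near `x` all lie on the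
> projective line `L_x := Proj(Dir_x(E)) ⊂ q⁻¹(x) ≃ ℙ²_{k(x)}`. … To prove (5), we may now choose
> `(y₁, y₂, y₃)` in such a way that `T_x = k(x)·Y₃`. For any `f ∈ J_x` with `ord_x f = μ`, we now
> have by (11) `y₁^{−μ} f ≡ λ_f y₃′^μ mod (y₁′)`, with `λ_f ≠ 0` and the conclusion follows."

and, in the words of the proof of Lemma 4.5 (2), p. 12: "By lemma 4.3 (5), `x′` is on the strict
transform of `div(z)` and on the exceptional divisor of `X′ → X`" — `z` a regular parameter whose
initial form `Z` spans the directrix `T_x = k(x)·Z`. Cossart–Jannsen–Saito, LNM 2270, Thm. 3.14 /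
Def. 6.38 (ii) (`C₁ = ℙ(Dir_x(X)) ≅ ℙ¹_{k(x)}`) is the same statement in Hilbert–Samuel language.

The tree has Hironaka's Theorem 2 for `ℙ²` at form level (`PlaneNearForms.directrix_le_dualVanishingAt`:
the directrix lies in the space `U(x′)` of linear forms through the near point), the chart
presentation of nearness (`NearPointsPointCentre.exists_chartResidueMap_forall_initialForms_near`), and
the cases `τ = 3` (no near point) and `τ = 2` (unique rational near point, `NearPointsPointCentreUnique`).
PROVED here, the case of ONE directrix line through a coordinate axis — which is the case `τ(x) = 1`
in adapted coordinates:

* ring level (`R` regular local of embedding dimension `3`, `c` a regular system of parameters, `𝔴`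
  a prime of the chart ring `B_j` of `Bl_𝔪(Spec R)` over `𝔪` at which all weak transforms of the
  degree-`μ` forms of `J` are near): `ne_and_chartGen_mem_of_near_point_of_proj_mem_directrix` —
  **if the coordinate form `Y_{j₀}` lies in the directrix `T(cl_μ J)`, then `j ≠ j₀` (no near point
  on the chart `Y_{j₀} ≠ 0`) and `e_{j₀} = c_{j₀}/c_j ∈ 𝔴` (the near point lies on the hyperplane
  `T_{j₀} = 0` of the exceptional `ℙ²`, i.e. on the strict transform of `div(c_{j₀})`)**;
  `proj_mem_directrix_of_hironakaTauAt_eq_one` — for `τ = 1` and `c` adapted at the two other indices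
  (`IsAdapted c J μ i`, `i ≠ j₀`: the directrix kills `e_i`), `Y_{j₀} ∈ T(cl_μ J)` (indeed
  `T = k·Y_{j₀}`, `TauOne`);
* scheme level (`π` the blowing up of a locally Noetherian `X` along a centre `Y` with
  `𝓘_{Y,x} = 𝔪_x = (c₀, c₁, c₂)` at `x = π x′`, `𝒪_{X,x}` regular of dimension `3`):
  `IsBlowup.exists_chart_index_of_isNear_point_of_proj_mem_directrix` — **for a near point `x′` there
  is an index `j ≠ j₀` with `𝔪_x 𝒪_{X′,x′} = (c_j)` (the point lies in the `c_j`-chart) and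
  `c_{j₀} ∈ c_j · 𝔪_{x′}` in `𝒪_{X′,x′}`** — `x′` lies on the exceptional divisor `div(c_j)` AND on
  the strict transform of `div(c_{j₀})`; and the intrinsic form
  `IsBlowup.stalkMap_mem_mul_of_isNear_point_of_proj_mem_directrix`:
  `c_{j₀} ∈ (𝔪_x 𝒪_{X′,x′}) · 𝔪_{x′}` (CJS's `IsOnProjDirectrix` reading for the form `Y_{j₀}`);
  `τ = 1` versions `…_of_stalkTau_eq_one` with adapted coordinates.

Not here: the line `L_x = E ∩ div(c_{j₀})′` as a closed regular irreducible curve of `X′` and its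
generic point (next file), curve centres (Lemma 4.3 (4)).

## Sources

* V. Cossart, O. Piltant, J. Algebra 320 (2008) 1051–1082, Lemma 4.3 (5), p. 8–9; proof of
  Lemma 4.5 (2), p. 12. [CossartPiltant2008]
* H. Hironaka, Ann. of Math. 92 (1970) 327–334, Thm. 2. [Hironaka1970]
* V. Cossart, U. Jannsen, S. Saito, LNM 2270 (2020), Thm. 3.14, Def. 6.38 (ii). [CossartJannsenSaito2020]
-/

noncomputable section

open CategoryTheory AlgebraicGeometry TopologicalSpace IsLocalRing

namespace Literature.AlgebraicGeometry.Resolution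

universe u

open Scheme.IdealSheafData

/-! ## Ring level -/

section Ring

variable {R : Type u} [CommRing R] [IsRegularLocalRing R]

/-- **`τ = 1` in adapted coordinates: the coordinate form spans the directrix.** If
`τ(cl_μ^{c} J) = 1` and the regular system of parameters `c` is adapted at every index `i ≠ j₀`
(`e_i` lies in the invariance space, i.e. every directrix form kills `e_i`), then the coordinate form
`Y_{j₀}` lies in (indeed spans) the directrix: `T = k·Y_{j₀}` ([CoP1]: "we may now choose
`(y₁, y₂, y₃)` in such a way that `T_x = k(x)·Y₃`"). [cite: CossartPiltant2008, Lemma 4.3 (5) (proof)] -/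
theorem proj_mem_directrix_of_hironakaTauAt_eq_one {d : ℕ} (c : Fin d → R) {J : Ideal R} {μ : ℕ}
    (j₀ : Fin d) (hτ : hironakaTauAt c J μ = 1) (had : ∀ i, i ≠ j₀ → IsAdapted c J μ i) :
    (LinearMap.proj j₀ : Module.Dual (ResidueField R) (Fin d → ResidueField R)) ∈
      directrix (ResidueField R) (initialForms c J μ : Set (MvPolynomial (Fin d) (ResidueField R))) := by
  obtain ⟨ℓ, hℓ0, hℓd, -⟩ := exists_forall_initialForms_eq_of_hironakaTauAt_eq_one c hτ
  -- `ℓ = ℓ(e_{j₀}) · Y_{j₀}`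
  have hℓi : ∀ i, i ≠ j₀ → ℓ (Pi.single i 1) = 0 := fun i hi => (had i hi).apply_single_eq_zero hℓd
  set a : ResidueField R := ℓ (Pi.single j₀ 1) with ha_def
  have hℓeq : ℓ = a • (LinearMap.proj j₀ : Module.Dual (ResidueField R) (Fin d → ResidueField R)) := by
    refine LinearMap.ext fun w => ?_
    rw [dual_apply_eq_sum (ResidueField R) ℓ w, LinearMap.smul_apply, LinearMap.proj_apply, smul_eq_mul,
      Finset.sum_eq_single j₀]
    · rw [← ha_def]; ring
    · intro i _ hi; rw [hℓi i hi, mul_zero]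
    · intro h; exact absurd (Finset.mem_univ _) h
  have ha : a ≠ 0 := by
    intro h; apply hℓ0; rw [hℓeq, h, zero_smul]
  have : (LinearMap.proj j₀ : Module.Dual (ResidueField R) (Fin d → ResidueField R)) = a⁻¹ • ℓ := by
    rw [hℓeq, smul_smul, inv_mul_cancel₀ ha, one_smul]
  rw [this]
  exact Submodule.smul_mem _ _ hℓd

/-- **[CoP1] Lemma 4.3 (5), ring level: near points lie on the hyperplane of the directrix form.**
Let `R` be regular local of embedding dimension `3`, `c` a regular system of parameters, `B_j` the
chart ring of the blowing up of `𝔪 = (c)` at the generator `c_j`, and `𝔴 ⊇ 𝔪B_j` a prime at which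
every weak transform `F(e)`, `F` a form of degree `μ` with `F(c) ∈ J`, lies in `𝔴^μ (B_j)_𝔴` (a
near point of the chart). If the coordinate form `Y_{j₀}` lies in the directrix `T(cl_μ J)`, then
`j ≠ j₀` — there is NO near point on the chart `Y_{j₀} ≠ 0` — and `e_{j₀} = c_{j₀}/c_j ∈ 𝔴`: the
near point lies on `{T_{j₀} = 0} ⊂ ℙ²`, the strict transform of `div(c_{j₀})`. (Hironaka's Theorem 2
for `ℙ²`, `directrix_le_dualVanishingAt`: `T ⊆ U(x′)`, and `Y_j ∉ U(x′)`.)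
[cite: CossartPiltant2008, Lemma 4.3 (5)] [cite: Hironaka1970, Thm. 2] -/
theorem ne_and_chartGen_mem_of_near_point_of_proj_mem_directrix
    (hd : (maximalIdeal R).spanFinrank = 3) (c : Fin 3 → R)
    (hc : Ideal.span (Set.range c) = maximalIdeal R) (j j₀ : Fin 3) {J : Ideal R} {μ : ℕ}
    (𝔴 : Ideal (chartRing c j)) [𝔴.IsPrime] (h𝔴 : (maximalIdeal R).map (chartBase c j) ≤ 𝔴)
    (hnear : ∀ F : MvPolynomial (Fin 3) R, F.IsHomogeneous μ → MvPolynomial.eval c F ∈ J →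
      (algebraMap (chartRing c j) (Localization.AtPrime 𝔴) :
          chartRing c j →+* Localization.AtPrime 𝔴)
          (MvPolynomial.eval₂Hom (chartBase c j) (fun i => chartGen c j i) F) ∈
        maximalIdeal (Localization.AtPrime 𝔴) ^ μ)
    (hdir : (LinearMap.proj j₀ : Module.Dual (ResidueField R) (Fin 3 → ResidueField R)) ∈
      directrix (ResidueField R) (initialForms c J μ : Set (MvPolynomial (Fin 3) (ResidueField R)))) :
    j ≠ j₀ ∧ chartGen c j j₀ ∈ 𝔴 := by
  classical
  obtain ⟨ρ, -, -, hρF, h𝔮, h𝔴eq, hS⟩ :=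
    exists_chartResidueMap_forall_initialForms_near hd c hc j 𝔴 h𝔴 hnear
  haveI := h𝔮
  have hmem := directrix_le_dualVanishingAt j (𝔴.map ρ) hS hdir
  have hne : j ≠ j₀ := by
    rintro rfl
    exact proj_not_mem_dualVanishingAt j (𝔴.map ρ) hmem
  refine ⟨hne, ?_⟩
  rw [mem_dualVanishingAt_iff, linearFormPoly_proj] at hmem
  have hde : dehomogenize j (MvPolynomial.X j₀ : MvPolynomial (Fin 3) (ResidueField R)) =
      MvPolynomial.X ⟨j₀, fun h => hne h.symm⟩ := by
    change MvPolynomial.aeval (killVar j) (MvPolynomial.X j₀) = _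
    rw [MvPolynomial.aeval_X, killVar_of_ne j (fun h => hne h.symm)]
  rw [hde, ← map_chartGen_of_chartResidueMap c j hρF (fun h => hne h.symm)] at hmem
  rw [h𝔴eq, Ideal.mem_comap]
  exact hmem

end Ring

/-! ## Scheme level -/

variable {X X' : Scheme.{u}} {π : X' ⟶ X}

/-- **[CoP1] Lemma 4.3 (5), scheme level, chart form.** Let `π` be the blowing up of the locally
Noetherian `X` along a centre `Y` with `𝓘_{Y,x} = 𝔪_x = (c₀, c₁, c₂)` at `x = π x′`, `𝒪_{X,x}`
regular of dimension `3`, and suppose the coordinate form `Y_{j₀}` lies in the directrix of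
`cl_μ(J_x)` (e.g. `τ(x) = 1` with `c` adapted). If `x′` is near for `(J, μ)`, then for some index
`j ≠ j₀`: `𝔪_x 𝒪_{X′,x′} = (c_j)` — the exceptional divisor is `div(c_j)` at `x′`, which lies in the
`c_j`-chart — and `c_{j₀} ∈ c_j · 𝔪_{x′}`, i.e. `c_{j₀}/c_j ∈ 𝔪_{x′}`: `x′` lies on the strict
transform of `div(c_{j₀})` (all images under `π^♯_{x′}`).
[cite: CossartPiltant2008, Lemma 4.3 (5); Hironaka1970, Thm. 2] -/
theorem IsBlowup.exists_chart_index_of_isNear_point_of_proj_mem_directrix [IsLocallyNoetherian X]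
    [IsLocallyNoetherian X'] {Y : Closeds X} (hπ : IsBlowup π (vanishingIdeal Y))
    {J : X.IdealSheafData} {μ : ℕ} {x' : X'} [IsRegularLocalRing (X.presheaf.stalk (π x'))]
    (hd : (maximalIdeal (X.presheaf.stalk (π x'))).spanFinrank = 3)
    {c : Fin 3 → X.presheaf.stalk (π x')} (hc : Ideal.span (Set.range c) = maximalIdeal _)
    (hcY : Ideal.span (Set.range c) = stalkIdeal (vanishingIdeal Y) (π x')) (j₀ : Fin 3)
    (hdir : (LinearMap.proj j₀ : Module.Dual (ResidueField (X.presheaf.stalk (π x')))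
        (Fin 3 → ResidueField (X.presheaf.stalk (π x')))) ∈
      directrix (ResidueField (X.presheaf.stalk (π x')))
        (initialForms c (stalkIdeal J (π x')) μ :
          Set (MvPolynomial (Fin 3) (ResidueField (X.presheaf.stalk (π x'))))))
    (hnear : IsNear π (vanishingIdeal Y) J μ x') :
    ∃ j : Fin 3, j ≠ j₀ ∧
      (maximalIdeal (X.presheaf.stalk (π x'))).map (π.stalkMap x').hom =
        Ideal.span {(π.stalkMap x').hom (c j)} ∧
      (π.stalkMap x').hom (c j₀) ∈
        Ideal.span {(π.stalkMap x').hom (c j)} * maximalIdeal (X'.presheaf.stalk x') := by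
  classical
  obtain ⟨j, 𝔴, χ, hχ, hloc, h𝔴⟩ := hπ.exists_reesChart_stalk x' c hcY
  letI := χ.toAlgebra
  haveI : IsLocalization.AtPrime (X'.presheaf.stalk x') 𝔴.asIdeal := hloc
  have hχalg : ∀ b, algebraMap (chartRing c j) (X'.presheaf.stalk x') b = χ b := fun b =>
    congrFun (congrArg DFunLike.coe (RingHom.algebraMap_toAlgebra χ)) b
  have h𝔴' : (maximalIdeal _).map (chartBase c j) ≤ 𝔴.asIdeal := by
    rw [← h𝔴]; exact Ideal.map_comap_le
  have hnearF : ∀ F : MvPolynomial (Fin 3) (X.presheaf.stalk (π x')), F.IsHomogeneous μ →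
      MvPolynomial.eval c F ∈ stalkIdeal J (π x') →
      (algebraMap (chartRing c j) (Localization.AtPrime 𝔴.asIdeal) :
          chartRing c j →+* Localization.AtPrime 𝔴.asIdeal)
          (MvPolynomial.eval₂Hom (chartBase c j) (fun i => chartGen c j i) F) ∈
        maximalIdeal (Localization.AtPrime 𝔴.asIdeal) ^ μ :=
    fun F hF hFJ => algebraMap_eval₂Hom_mem_pow_of_isNear hcY j 𝔴 χ hχ hloc hnear hF hFJ
  obtain ⟨hne, hmem⟩ :=
    ne_and_chartGen_mem_of_near_point_of_proj_mem_directrix hd c hc j j₀ 𝔴.asIdeal h𝔴' hnearF hdir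
  -- `𝔪 B_j = (c_j)`, transported to the stalk
  have hu : ∀ l, chartBase c j (c l) = chartBase c j (c j) * chartGen c j l :=
    fun l => reesChartBase_apply_eq_mul_chartGen c j l
  have hK : (maximalIdeal (X.presheaf.stalk (π x'))).map (chartBase c j) =
      Ideal.span {chartBase c j (c j)} := by
    rw [← hc]
    exact Ideal.map_span_range_eq_span_singleton _ c j _ hu
  have hmapχ : (maximalIdeal (X.presheaf.stalk (π x'))).map (π.stalkMap x').hom =
      Ideal.span {(π.stalkMap x').hom (c j)} := by
    have h1 : (π.stalkMap x').hom = χ.comp (chartBase c j) := RingHom.ext fun a => (hχ a).symm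
    rw [h1, ← Ideal.map_map, hK, Ideal.map_span, Set.image_singleton, RingHom.comp_apply]
  refine ⟨j, hne, hmapχ, ?_⟩
  -- `c_{j₀} = c_j · e_{j₀}` with `e_{j₀} ∈ 𝔴`, hence `χ e_{j₀} ∈ 𝔪_{x′}`
  have hgen : χ (chartGen c j j₀) ∈ maximalIdeal (X'.presheaf.stalk x') := by
    rw [← hχalg]
    exact (IsLocalization.AtPrime.to_map_mem_maximal_iff (X'.presheaf.stalk x') 𝔴.asIdeal _).mpr hmem
  have h1 : (π.stalkMap x').hom (c j₀) = (π.stalkMap x').hom (c j) * χ (chartGen c j j₀) := by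
    rw [← hχ (c j₀), ← hχ (c j), hu j₀, map_mul]
  rw [h1]
  exact Ideal.mul_mem_mul (Ideal.subset_span rfl) hgen

/-- **[CoP1] Lemma 4.3 (5), scheme level, intrinsic form**: in the situation of
`IsBlowup.exists_chart_index_of_isNear_point_of_proj_mem_directrix`, the image of `c_{j₀}` in
`𝒪_{X′,x′}` lies in `(𝔪_x 𝒪_{X′,x′}) · 𝔪_{x′}` — the degree-one form `Y_{j₀}` vanishes at the point
`x′` of the exceptional `ℙ²` (Cossart–Jannsen–Saito's `ξ ∈ ℙ(Dir_x)` for the form `Y_{j₀}`).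
[cite: CossartPiltant2008, Lemma 4.3 (5)] [cite: CossartJannsenSaito2020, Thm. 3.14] -/
theorem IsBlowup.stalkMap_mem_mul_of_isNear_point_of_proj_mem_directrix [IsLocallyNoetherian X]
    [IsLocallyNoetherian X'] {Y : Closeds X} (hπ : IsBlowup π (vanishingIdeal Y))
    {J : X.IdealSheafData} {μ : ℕ} {x' : X'} [IsRegularLocalRing (X.presheaf.stalk (π x'))]
    (hd : (maximalIdeal (X.presheaf.stalk (π x'))).spanFinrank = 3)
    {c : Fin 3 → X.presheaf.stalk (π x')} (hc : Ideal.span (Set.range c) = maximalIdeal _)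
    (hcY : Ideal.span (Set.range c) = stalkIdeal (vanishingIdeal Y) (π x')) (j₀ : Fin 3)
    (hdir : (LinearMap.proj j₀ : Module.Dual (ResidueField (X.presheaf.stalk (π x')))
        (Fin 3 → ResidueField (X.presheaf.stalk (π x')))) ∈
      directrix (ResidueField (X.presheaf.stalk (π x')))
        (initialForms c (stalkIdeal J (π x')) μ :
          Set (MvPolynomial (Fin 3) (ResidueField (X.presheaf.stalk (π x'))))))
    (hnear : IsNear π (vanishingIdeal Y) J μ x') :
    (π.stalkMap x').hom (c j₀) ∈
      (maximalIdeal (X.presheaf.stalk (π x'))).map (π.stalkMap x').hom *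
        maximalIdeal (X'.presheaf.stalk x') := by
  obtain ⟨j, -, hmap, hmem⟩ :=
    hπ.exists_chart_index_of_isNear_point_of_proj_mem_directrix hd hc hcY j₀ hdir hnear
  rw [hmap]
  exact hmem

/-- **[CoP1] Lemma 4.3 (5) for `τ(x) = 1`, chart form**: with a regular system of parameters `c` at
`x` adapted at the indices `≠ j₀` (so `T_x = k(x)·Y_{j₀}`), every near point `x′` over `x` lies, for
some `j ≠ j₀`, in the `c_j`-chart (`𝔪_x 𝒪_{X′,x′} = (c_j)`) and on the strict transform of
`div(c_{j₀})` (`c_{j₀} ∈ c_j · 𝔪_{x′}`). [cite: CossartPiltant2008, Lemma 4.3 (5)] -/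
theorem IsBlowup.exists_chart_index_of_isNear_point_of_stalkTau_eq_one [IsLocallyNoetherian X]
    [IsLocallyNoetherian X'] {Y : Closeds X} (hπ : IsBlowup π (vanishingIdeal Y))
    {J : X.IdealSheafData} {μ : ℕ} {x' : X'} [IsRegularLocalRing (X.presheaf.stalk (π x'))]
    (hd : (maximalIdeal (X.presheaf.stalk (π x'))).spanFinrank = 3)
    {c : Fin 3 → X.presheaf.stalk (π x')} (hc : Ideal.span (Set.range c) = maximalIdeal _)
    (hcY : Ideal.span (Set.range c) = stalkIdeal (vanishingIdeal Y) (π x')) (j₀ : Fin 3)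
    (hτ : stalkTau J (π x') μ = 1) (had : ∀ i, i ≠ j₀ → IsAdapted c (stalkIdeal J (π x')) μ i)
    (hnear : IsNear π (vanishingIdeal Y) J μ x') :
    ∃ j : Fin 3, j ≠ j₀ ∧
      (maximalIdeal (X.presheaf.stalk (π x'))).map (π.stalkMap x').hom =
        Ideal.span {(π.stalkMap x').hom (c j)} ∧
      (π.stalkMap x').hom (c j₀) ∈
        Ideal.span {(π.stalkMap x').hom (c j)} * maximalIdeal (X'.presheaf.stalk x') := by
  have hτc : hironakaTauAt c (stalkIdeal J (π x')) μ = 1 := by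
    rw [← stalkTau_eq J (π x') μ hd c hc]; exact hτ
  exact hπ.exists_chart_index_of_isNear_point_of_proj_mem_directrix hd hc hcY j₀
    (proj_mem_directrix_of_hironakaTauAt_eq_one c j₀ hτc had) hnear

/-- **[CoP1] Lemma 4.3 (5) for `τ(x) = 1`, intrinsic form**: `c_{j₀} ∈ (𝔪_x 𝒪_{X′,x′}) · 𝔪_{x′}` at
every near point `x′` over `x`, for `c` adapted at the indices `≠ j₀`.
[cite: CossartPiltant2008, Lemma 4.3 (5)] -/
theorem IsBlowup.stalkMap_mem_mul_of_isNear_point_of_stalkTau_eq_one [IsLocallyNoetherian X]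
    [IsLocallyNoetherian X'] {Y : Closeds X} (hπ : IsBlowup π (vanishingIdeal Y))
    {J : X.IdealSheafData} {μ : ℕ} {x' : X'} [IsRegularLocalRing (X.presheaf.stalk (π x'))]
    (hd : (maximalIdeal (X.presheaf.stalk (π x'))).spanFinrank = 3)
    {c : Fin 3 → X.presheaf.stalk (π x')} (hc : Ideal.span (Set.range c) = maximalIdeal _)
    (hcY : Ideal.span (Set.range c) = stalkIdeal (vanishingIdeal Y) (π x')) (j₀ : Fin 3)
    (hτ : stalkTau J (π x') μ = 1) (had : ∀ i, i ≠ j₀ → IsAdapted c (stalkIdeal J (π x')) μ i)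
    (hnear : IsNear π (vanishingIdeal Y) J μ x') :
    (π.stalkMap x').hom (c j₀) ∈
      (maximalIdeal (X.presheaf.stalk (π x'))).map (π.stalkMap x').hom *
        maximalIdeal (X'.presheaf.stalk x') := by
  obtain ⟨j, -, hmap, hmem⟩ :=
    hπ.exists_chart_index_of_isNear_point_of_stalkTau_eq_one hd hc hcY j₀ hτ had hnear
  rw [hmap]
  exact hmem

end Literature.AlgebraicGeometry.Resolution

end
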